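import Mathlib.CategoryTheory.SingleObj
import Mathlib.NumberTheory.LegendreSymbol.QuadraticChar.Basic
import Literature.IUT.HodgeTheaters.PMBaseKit

/-!
# A model of the base interface `PMBaseKit` (consistency witness)

`PMBaseKit l` (`PMBaseKit.lean`) packages the outputs of the reconstruction statements of [IUTchI]
Def 6.1 (ii)–(vii) as a hypothesis structure. This file builds, for every prime `l ≠ 2`, an honest
inhabitant `PMBaseKit.toyKit l` with a valuation (`𝕍 = Unit`), so that no combination of the kit's
fields is vacuous ([IUTchI] Def 6.1 p. 156) [claim: Mochizuki2012, status: disputed]. The model is the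
"combinatorial shadow" of the intended one:

* at the (single) place, the ambient category is the two-object *collage* category `Obj l` with
  `Hom(loc, loc) = {±1}`, `Hom(glob, glob) = AGL₁(𝔽_l) = 𝔽_l ⋊ 𝔽_l^×`, `Hom(loc, glob) = AGL₁(𝔽_l)`,
  `Hom(glob, loc) = ∅` — `loc` plays `𝒟_v` (its automorphisms act on the `l` label classes of cusps
  through `{±1}`), `glob` plays `𝒟^{⊚±}` seen at `v` (its automorphisms `Aut(X_K) ↠ 𝔽_l^⋇` act on the
  `l` cusps through the affine group, `Aut_± = 𝔽_l ⋊ {±1}`), and a morphism `loc → glob` is "what it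
  does on cusps";
* the global category is the one-object category on `AGL₁(𝔽_l)`; `Aut ↠ 𝔽_l^⋇` is `(b, a) ↦ [a]`;
* `LabCusp^± = 𝔽_l` everywhere, with the tautological `𝔽_l^±`-group (at `loc`) and `𝔽_l^±`-torsor
  (at `𝒟^{⊚±}`) structures of `LabelsPlusMinus*.lean`; `φ^{Θell}_{•,v} = 1`.
-/

namespace Literature.IUT.HodgeTheaters

open CategoryTheory

namespace PMBaseKit

namespace Model

variable (l : ℕ)

/-! ### The affine group `AGL₁(𝔽_l) = 𝔽_l ⋊ 𝔽_l^×` and its action on `𝔽_l` -/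

/-- `𝔽_l^×` acting on `𝔽_l` by multiplication, as automorphisms of `Multiplicative 𝔽_l`. (model plumbing for [IUTchI] Def 6.1 p. 156) [claim: Mochizuki2012, status: disputed] -/
def unitAct : (ZMod l)ˣ →* MulAut (Multiplicative (ZMod l)) where
  toFun a := AddEquiv.toMultiplicative (DistribMulAction.toAddEquiv (ZMod l) a)
  map_one' := by ext x; simp
  map_mul' a b := by ext x; simp [mul_smul]

/-- (model plumbing) [folklore] -/
@[simp] private theorem unitAct_apply (a : (ZMod l)ˣ) (x : Multiplicative (ZMod l)) :
    unitAct l a x = Multiplicative.ofAdd ((a : ZMod l) * x.toAdd) := rfl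

/-- The affine group `AGL₁(𝔽_l) = 𝔽_l ⋊ 𝔽_l^×` (the model's `Aut(𝒟^{⊚±})`). (model plumbing for [IUTchI] Def 6.1 p. 156) [claim: Mochizuki2012, status: disputed] -/
abbrev AGL : Type := SemidirectProduct (Multiplicative (ZMod l)) (ZMod l)ˣ (unitAct l)

/-- The affine action `(b, a) • z = a z + b` of `AGL₁(𝔽_l)` on `𝔽_l` (the model's cusps). (model plumbing for [IUTchI] Def 6.1 p. 156) [claim: Mochizuki2012, status: disputed] -/
instance : MulAction (AGL l) (ZMod l) where
  smul g z := (g.right : ZMod l) * z + g.left.toAdd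
  one_smul z := by
    change ((1 : AGL l).right : ZMod l) * z + (1 : AGL l).left.toAdd = z
    simp
  mul_smul g h z := by
    change ((g * h).right : ZMod l) * z + (g * h).left.toAdd =
      (g.right : ZMod l) * ((h.right : ZMod l) * z + h.left.toAdd) + g.left.toAdd
    rw [SemidirectProduct.mul_right, SemidirectProduct.mul_left, unitAct_apply, toAdd_mul, toAdd_ofAdd,
      Units.val_mul]
    ring

/-- (model plumbing) [folklore] -/
private theorem agl_smul_def (g : AGL l) (z : ZMod l) : g • z = (g.right : ZMod l) * z + g.left.toAdd := rfl

/-- The affine action as a homomorphism to permutations. (model plumbing for [IUTchI] Def 6.1 p. 156) [claim: Mochizuki2012, status: disputed] -/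
def aglPerm : AGL l →* Equiv.Perm (ZMod l) := MulAction.toPermHom (AGL l) (ZMod l)

/-- (model plumbing) [folklore] -/
@[simp] private theorem aglPerm_apply (g : AGL l) (z : ZMod l) : aglPerm l g z = g • z := rfl

/-- The signs `{±1} = ℤˣ` inside `AGL₁(𝔽_l)` as `z ↦ ±z`. (model plumbing for [IUTchI] Def 6.1 p. 156) [claim: Mochizuki2012, status: disputed] -/
def signToAGL : ℤˣ →* AGL l :=
  SemidirectProduct.inr.comp (Units.map (Int.castRingHom (ZMod l)).toMonoidHom)

/-- (model plumbing) the sign `ε` acts on `𝔽_l` by `z ↦ ε • z`. [folklore] -/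
private theorem aglPerm_signToAGL (ε : ℤˣ) : aglPerm l (signToAGL l ε) = signPerm l ε := by
  ext z
  simp [signToAGL, agl_smul_def, Units.smul_def, zsmul_eq_mul]

/-- The elements `(c, ±1) ∈ AGL₁(𝔽_l)` realising `𝔽_l^{⋊±}` inside the affine group. (model plumbing for [IUTchI] Def 6.1 p. 156) [claim: Mochizuki2012, status: disputed] -/
def pmToAGL : FlPM l →* AGL l :=
  SemidirectProduct.map (MonoidHom.id _) (Units.map (Int.castRingHom (ZMod l)).toMonoidHom)
    (fun ε => by ext x; simp [Units.smul_def, zsmul_eq_mul])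

/-- (model plumbing) `pmToAGL` is compatible with the two actions on `𝔽_l`. [folklore] -/
private theorem aglPerm_pmToAGL (g : FlPM l) : aglPerm l (pmToAGL l g) = FlPM.toPerm l g := by
  ext z
  simp [pmToAGL, agl_smul_def, FlPM.smul_def, Units.smul_def, zsmul_eq_mul]

/-! ### The collage category at a place -/

/-- Objects of the model ambient category at a place: `loc` (the model `𝒟_v`) and `glob` (the model
`𝒟^{⊚±}` seen at `v`). (model plumbing for [IUTchI] Def 6.1 p. 156) [claim: Mochizuki2012, status: disputed] -/
inductive Obj (l : ℕ) : Type
  /-- the local object -/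
  | loc
  /-- the global object seen at the place -/
  | glob

/-- Morphisms of the collage category. (model plumbing for [IUTchI] Def 6.1 p. 156) [claim: Mochizuki2012, status: disputed] -/
@[reducible] def Hom : Obj l → Obj l → Type
  | .loc, .loc => ℤˣ
  | .loc, .glob => AGL l
  | .glob, .glob => AGL l
  | .glob, .loc => PEmpty

/-- Composition in the collage category (`g ∘ f` read on cusps). (model plumbing for [IUTchI] Def 6.1 p. 156) [claim: Mochizuki2012, status: disputed] -/
@[reducible] def comp : ∀ {X Y Z : Obj l}, Hom l X Y → Hom l Y Z → Hom l X Z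
  | .loc, .loc, .loc, f, g => g * f
  | .loc, .loc, .glob, f, g => g * signToAGL l f
  | .loc, .glob, .glob, f, g => g * f
  | .glob, .glob, .glob, f, g => g * f
  | .glob, .loc, _, f, _ => f.elim
  | .loc, .glob, .loc, _, g => g.elim
  | .glob, .glob, .loc, _, g => g.elim

/-- The collage category structure. (model plumbing for [IUTchI] Def 6.1 p. 156) [claim: Mochizuki2012, status: disputed] -/
instance : Category (Obj l) where
  Hom := Hom l
  id X := match X with
    | .loc => (1 : ℤˣ)
    | .glob => (1 : AGL l)
  comp := comp l
  id_comp := by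
    rintro (_ | _) (_ | _) f
    · exact mul_one f
    · change f * signToAGL l 1 = f
      rw [map_one, mul_one]
    · exact f.elim
    · exact mul_one f
  comp_id := by
    rintro (_ | _) (_ | _) f
    · exact one_mul f
    · exact one_mul f
    · exact f.elim
    · exact one_mul f
  assoc := by
    rintro (_ | _) (_ | _) (_ | _) (_ | _) f g h <;>
      first
      | exact f.elim
      | exact g.elim
      | exact h.elim
      | simp only [comp, map_mul, mul_assoc]

/-- "What a morphism does on the `l` cusps": every morphism of the collage category acts on `𝔽_l`.
(model plumbing for [IUTchI] Def 6.1 p. 156) [claim: Mochizuki2012, status: disputed] -/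
def homPerm : ∀ {X Y : Obj l}, (X ⟶ Y) → Equiv.Perm (ZMod l)
  | .loc, .loc, f => signPerm l f
  | .loc, .glob, f => aglPerm l f
  | .glob, .glob, f => aglPerm l f
  | .glob, .loc, f => f.elim

/-- (model plumbing) functoriality of `homPerm`. [folklore] -/
private theorem homPerm_comp {X Y Z : Obj l} (f : X ⟶ Y) (g : Y ⟶ Z) :
    homPerm l (f ≫ g) = (homPerm l f).trans (homPerm l g) := by
  rcases X with _ | _ <;> rcases Y with _ | _ <;> rcases Z with _ | _ <;>
    first
    | exact f.elim
    | exact g.elim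
    | change homPerm l (comp l f g) = _
      ext z
      simp [homPerm, comp, agl_smul_def, ← aglPerm_signToAGL, Equiv.Perm.mul_def]

/-- (model plumbing) `homPerm` of identities. [folklore] -/
private theorem homPerm_id (X : Obj l) : homPerm l (𝟙 X) = Equiv.refl _ := by
  rcases X with _ | _
  · change signPerm l 1 = _; ext z; simp
  · change aglPerm l 1 = _; rw [map_one]; rfl

/-- There is no isomorphism `glob ≅ loc`. [folklore] -/
private theorem not_iso_glob_loc (φ : (Obj.glob : Obj l) ≅ Obj.loc) : False := (φ.hom : PEmpty).elim

/-! ### The global one-object category and `Aut ↠ 𝔽_l^⋇` -/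

/-- Automorphisms of the single object as elements of the monoid. (model plumbing for [IUTchI] Def 6.1 p. 156) [claim: Mochizuki2012, status: disputed] -/
def autToGroup {M : Type} [Monoid M] (x : SingleObj M) : Aut x →* M where
  toFun α := α.hom
  map_one' := rfl
  map_mul' _ _ := rfl

/-- `Aut(𝒟^{⊚±}) ↠ 𝔽_l^⋇`, `(b, a) ↦ [a]`. (model plumbing for [IUTchI] Def 6.1 p. 156) [claim: Mochizuki2012, status: disputed] -/
def toFlStar' (x : SingleObj (AGL l)) : Aut x →* FlStar l :=
  ((QuotientGroup.mk' (unitsPlusMinus l)).comp SemidirectProduct.rightHom).comp (autToGroup x)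

/-- (model plumbing) surjectivity of `Aut ↠ 𝔽_l^⋇`. [folklore] -/
private theorem toFlStar'_surjective (x : SingleObj (AGL l)) : Function.Surjective (toFlStar' l x) := by
  rintro ⟨a⟩
  refine ⟨⟨SemidirectProduct.inr a, SemidirectProduct.inr a⁻¹, ?_, ?_⟩, rfl⟩ <;>
    simp [SingleObj.comp_as_mul, SingleObj.id_as_one]

/-- The functor `glob ↦` the global object seen at the place. (model plumbing for [IUTchI] Def 6.1 p. 156) [claim: Mochizuki2012, status: disputed] -/
def atV' : SingleObj (AGL l) ⥤ Obj l where
  obj _ := Obj.glob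
  map f := f
  map_id _ := rfl
  map_comp _ _ := rfl

end Model

open Model

variable (l : ℕ)

/-! ### The kit -/

/-- **A model of `PMBaseKit l` for every prime `l ≠ 2`** with one valuation: consistency witness for
the interface of [IUTchI] Def 6.1 (ii)–(vii) ([IUTchI] Def 6.1 p. 156). All structure fields are
genuine (no empty types): `𝕍 = Unit`, `Amb = Obj l`, `Glob` the one-object category on `AGL₁(𝔽_l)`.
([IUTchI] Def 6.1 p.156) [claim: Mochizuki2012, status: disputed] -/
noncomputable def toyKit [Fact l.Prime] (hl : l ≠ 2) : PMBaseKit.{0} l where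
  V := Unit
  bad := ∅
  arc := ∅
  Amb _ := Obj l
  model _ := Obj.loc
  pmObj _ X := X
  toPM _ X := 𝟙 X
  LabCuspPM _ _ := ZMod l
  labPM _ _ _ := FlPMGroup.tautological l
  labMap := fun _ {X Y} φ => homPerm l φ.hom
  labMap_refl := fun _ X => homPerm_id l X
  labMap_trans := fun _ {X Y Z} φ ψ => homPerm_comp l φ.hom ψ.hom
  labMap_charts := by
    rintro _ (_ | _) (_ | _) hX hY φ e ⟨ε, rfl⟩
    · exact ⟨ε * φ.hom, by ext z; simp [homPerm, mul_smul]⟩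
    · exact (not_iso_glob_loc l φ.symm).elim
    · exact (not_iso_glob_loc l φ).elim
    · exact (not_iso_glob_loc l hX.some).elim
  exists_negative := by
    rintro _ (_ | _) hX
    · refine ⟨⟨(-1 : ℤˣ), (-1 : ℤˣ), ?_, ?_⟩, fun h => ?_⟩
      · change (-1 : ℤˣ) * (-1) = 1
        simp
      · change (-1 : ℤˣ) * (-1) = 1
        simp
      have h1 := congrArg (fun σ => σ (1 : ZMod l)) h
      simp only [homPerm, signPerm_apply, Units.smul_def, Units.val_neg, Units.val_one, neg_smul,
        one_smul, Equiv.refl_apply] at h1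
      have h2 : ringChar (ZMod l) = 2 := neg_one_eq_one_iff.mp h1
      rw [ZMod.ringChar_zmod_n] at h2
      exact hl h2
    · exact (not_iso_glob_loc l hX.some).elim
  Glob := SingleObj (AGL l)
  gModel := SingleObj.star _
  gIso _ := ⟨Iso.refl _⟩
  GLab _ := ZMod l
  gLabMap := fun {G H} φ => aglPerm l φ.hom
  gLabMap_refl _ := by change aglPerm l 1 = _; rw [map_one]; rfl
  gLabMap_trans := fun {G H K} φ ψ => by
    change aglPerm l (φ.hom ≫ ψ.hom) = _
    rw [SingleObj.comp_as_mul, map_mul, Equiv.Perm.mul_def]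
  toFlStar := toFlStar' l
  toFlStar_surjective := toFlStar'_surjective l
  gLabT := FlPMTorsor.tautological l
  gChart₀ := FlPM.toPerm l 1
  gChart₀_mem := ⟨1, rfl⟩
  autCsp_le := by
    intro G α h
    have h0 := congrArg (fun σ => σ (0 : ZMod l)) h
    have h1 := congrArg (fun σ => σ (1 : ZMod l)) h
    simp only [aglPerm_apply, agl_smul_def, mul_zero, zero_add, mul_one, Equiv.refl_apply] at h0 h1
    rw [h0, add_zero] at h1
    have hr : α.hom.right = 1 := Units.ext h1
    change QuotientGroup.mk' _ (SemidirectProduct.rightHom α.hom) = 1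
    rw [SemidirectProduct.rightHom_eq_right, hr, map_one]
  gLab_range := by
    intro σ
    constructor
    · intro hσ
      obtain ⟨g, hg⟩ := hσ (FlPM.toPerm l 1) ⟨1, rfl⟩
      refine ⟨⟨pmToAGL l g, pmToAGL l g⁻¹, by simp [SingleObj.comp_as_mul, SingleObj.id_as_one],
        by simp [SingleObj.comp_as_mul, SingleObj.id_as_one]⟩, ?_, ?_⟩
      · change QuotientGroup.mk' _ (SemidirectProduct.rightHom (pmToAGL l g)) = 1
        rw [QuotientGroup.mk'_apply, QuotientGroup.eq_one_iff, mem_unitsPlusMinus_iff]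
        rcases Int.units_eq_one_or g.right with h | h
        · exact Or.inl (Units.ext (by simp [pmToAGL, h]))
        · exact Or.inr (Units.ext (by simp [pmToAGL, h]))
      · change aglPerm l (pmToAGL l g) = σ
        rw [aglPerm_pmToAGL]
        ext z
        have := hg z
        simp only [FlPM.toPerm_apply, one_smul] at this
        simpa using this.symm
    · rintro ⟨α, hα, rfl⟩
      -- `α = (b, a)` with `a = ±1` is the image of an element `h ∈ 𝔽_l^{⋊±}`
      have ha : (α.hom.right : (ZMod l)ˣ) ∈ unitsPlusMinus l := by
        change QuotientGroup.mk' _ (SemidirectProduct.rightHom α.hom) = 1 at hα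
        rwa [QuotientGroup.mk'_apply, QuotientGroup.eq_one_iff, SemidirectProduct.rightHom_eq_right] at hα
      obtain ⟨h, hh⟩ : ∃ h : FlPM l, pmToAGL l h = α.hom := by
        rw [mem_unitsPlusMinus_iff] at ha
        rcases ha with ha | ha
        · exact ⟨FlPM.mk α.hom.left.toAdd 1,
            SemidirectProduct.ext (by simp [pmToAGL, FlPM.mk]) (by rw [ha]; exact Units.ext (by simp [pmToAGL, FlPM.mk]))⟩
        · exact ⟨FlPM.mk α.hom.left.toAdd (-1),
            SemidirectProduct.ext (by simp [pmToAGL, FlPM.mk]) (by rw [ha]; exact Units.ext (by simp [pmToAGL, FlPM.mk]))⟩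
      rintro e ⟨g, rfl⟩
      refine ⟨g * h * g⁻¹, fun t => ?_⟩
      change FlPM.toPerm l g (aglPerm l α.hom t) = (g * h * g⁻¹) • FlPM.toPerm l g t
      rw [← hh, aglPerm_pmToAGL]
      simp [mul_smul]
  atV _ := atV' l
  phiEll _ := (1 : AGL l)
  labOfHom := fun _ {X G} f => ⇑(homPerm l f)
  labOfHom_pre := fun _ {X Y G} φ f => by
    change ⇑(homPerm l (φ.hom ≫ f)) = _
    rw [homPerm_comp]
    rfl
  labOfHom_post := fun _ {X G H} f ψ => by
    change ⇑(homPerm l (f ≫ (atV' l).map ψ.hom)) = _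
    rw [homPerm_comp]
    rfl
  labOfHom_phiEll_bijective _ := by
    change Function.Bijective (aglPerm l 1)
    rw [map_one]
    exact (Equiv.refl _).bijective
  labOfHom_phiEll_charts := by
    rintro _ e ⟨ε, rfl⟩
    refine ⟨FlPM.mk 0 ε, ?_⟩
    ext z
    change (FlPM.mk (0 : ZMod l) ε) • z = ε • (Equiv.ofBijective _ _).symm z
    generalize hw : (Equiv.ofBijective _ _).symm z = w
    rw [Equiv.symm_apply_eq] at hw
    change z = (1 : AGL l) • w at hw
    rw [one_smul] at hw
    subst hw
    simp [FlPM.smul_def, FlPM.mk]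

end PMBaseKit

end Literature.IUT.HodgeTheaters
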